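import Summits.Ventures.LatticeQCDFlow.Scaling.DensityParityESS
import HarnessLib

/-!
# LatticeQCDFlow / Scaling — the target-side parity leg: the ESS column is certified up to the
# target-weighted importance mass of the exceptional set

HONEST FRAMING: exact (Metropolis-corrected) sampling algorithms for lattice gauge theory;
figures of merit are autocorrelation/cost numbers at stated couplings and volumes; no
continuum-physics claim.

Venture `LatticeQCDFlow` (cell pub-lqcd), topic `Scaling`; FANOUT row 4 (`s0-u1-b`, rung S0-B:
two independent implementations of the 2D U(1) flow sampler compared column by column).  Third
companion of `Scaling/DensityParityCertificates.lean` (the ACCEPTANCE column is certified by a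
log-density parity `δ` that holds only off an exceptional set `E`, up to the MODEL masses
`q(E) + q'(E)`) and `Scaling/DensityParityESS.lean` (the ESS column is pinned by a UNIFORM parity
and by nothing weaker in model probability: two-point witness).  NEW WORK of the cell, elementary
finite sums over `Scaling/ImportanceWeights.lean` (`essFrac_eq_inv`: `1/ESS(p, q) = E_p[w] = Σ p·w`,
`w = p/q`); nothing is cited as a fact, no definition is introduced.

## What is proved (finite state space; `p` a probability vector — no sign hypothesis is needed
except in the last lemma, since `p·w = p²/q ≥ 0` — `q, q' > 0` models,
`w = p/q`, `w' = p/q'`; `E` any finite set of states; parity `|log q x − log q' x| ≤ δ` for `x ∉ E`)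

Write `m_{Eᶜ} = Σ_{x ∉ E} p x · w x`, `m_E = Σ_{x ∈ E} p x · w x`, `m'_E = Σ_{x ∈ E} p x · w' x` — the
TARGET-WEIGHTED IMPORTANCE MASSES (`1/ESS(p, q) = m_{Eᶜ} + m_E`).

* §1 pointwise: `le_exp_mul_and_of_abs_log_sub_le`, `mul_weight_le_exp_mul_of_model_le`
  (`q ≤ e^δ q'` at `x` ⇒ `p·w' ≤ e^δ·p·w` at `x`), `abs_mul_weight_sub_le_of_abs_log_sub_le`
  (`|p·w − p·w'| ≤ (e^δ − 1)·p·w` at a parity point).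
* §2 THE LAW.  **`inv_essFrac_le_of_logParityOff`** / **`inv_essFrac_ge_of_logParityOff`**:
  `e^{−δ}·m_{Eᶜ} + m'_E ≤ 1/ESS(p, q') ≤ e^{δ}·m_{Eᶜ} + m'_E`;
  **`abs_inv_essFrac_sub_le_of_logParityOff`**: `|1/ESS(p, q) − 1/ESS(p, q')| ≤ (e^δ − 1)·m_{Eᶜ} + m_E + m'_E`;
  on the ESS scale (`Σ q = Σ q' = 1`, `δ ≥ 0`) **`abs_essFrac_sub_le_of_logParityOff`**:
  `|ESS(p, q) − ESS(p, q')| ≤ (e^δ − 1)·ESS(p, q') + m_E + m'_E ≤ (e^δ − 1) + m_E + m'_E`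
  (`abs_essFrac_sub_le_exp_sub_one_add_weightMass`).
* §3 WHAT THE EXCEPTIONAL TERM IS.  `sum_mul_weight_le_inv_essFrac` (`m_E ≤ 1/ESS`: the law cannot
  lose the term — with `q = p`, `1/ESS(p, q') ≥ m'_E` while every other term is `≤ 2ε + (e^δ − 1)`);
  `sum_mul_weight_eq_sum_model_mul_weight_sq` (`m_E = Σ_{x ∈ E} q x · (w x)²`: a target MEAN of the
  weight on `E` is a model SECOND MOMENT of it); `sq_sum_div_sum_le_sum_mul_weight`
  (`m_E ≥ p(E)²/q(E) = p(E)·(p(E)/q(E))`, Cauchy–Schwarz) and `sum_mul_weight_le_mul_sum_of_weight_le`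
  (`m_E ≤ W·p(E)` if `w ≤ W` on `E`): the exceptional term is the target mass of `E` times the weight
  LEVEL on `E`, never the target mass alone.

Reading for row 4's A-vs-B table (value-free; no number of ours, no sealed value).  Put side by
side with the two companions, the three leaderboard columns see an exceptional set `E` of a
non-uniform parity through three different functionals: the acceptance through the MODEL masses
`q(E), q'(E)`; the ESS through the TARGET-WEIGHTED importance masses `m_E, m'_E`; the integrated
autocorrelation time through no mass at all (two-point witness of `DensityParityCertificates` §2:
`τ' = p(E)/q'(E) − 1/2` at `p(E) = q(E) = ε`).  With `E = {parity fails}` decidable per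
configuration by running both codes, `m_E` and `m'_E` are plain TARGET expectations of
`w·1_E`, `w'·1_E` — what a parity leg run on target-distributed configurations (the accepted chain)
averages — whereas on model draws the same numbers are second moments of the weights on `E` (§3),
the heavy-tailed statistic.  On the two-point family (`p = (1 − ε, ε) = q`, `q' = (1 − εη, εη)`,
`E = {1}`): `m_E = ε` but `m'_E = ε/η = p(E)·w'(1)`, which is the whole of `1/ESS' − 1` up to `2ε`.
NOT CLAIMED: any statistical statement (confidence bounds for `m_E` from finitely many draws);
anything about `τ_int`; sample (estimated) ESS; any number re-scored; HMC / local Metropolis.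
-/

namespace Summit.Ventures.LatticeQCDFlow.Theory2.DensityParity

open Finset
open Literature.Probability.MarkovChains
open Summit.Ventures.LatticeQCDFlow.Exactness

variable {X : Type*} [Fintype X]

/-! ### §1 Pointwise parity-to-weight transfer -/

section Pointwise

/-- Two-sided parity-to-ratio: for `a, b > 0` with `|log a − log b| ≤ δ`, `a ≤ e^δ·b` and
`b ≤ e^δ·a`. [folklore] -/
theorem le_exp_mul_and_of_abs_log_sub_le {a b δ : ℝ} (ha : 0 < a) (hb : 0 < b)
    (h : |Real.log a - Real.log b| ≤ δ) : a ≤ Real.exp δ * b ∧ b ≤ Real.exp δ * a := by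
  rw [abs_sub_le_iff] at h
  constructor
  · have h1 : Real.log a ≤ δ + Real.log b := by linarith [h.1]
    calc a = Real.exp (Real.log a) := (Real.exp_log ha).symm
      _ ≤ Real.exp (δ + Real.log b) := Real.exp_le_exp.2 h1
      _ = Real.exp δ * b := by rw [Real.exp_add, Real.exp_log hb]
  · have h2 : Real.log b ≤ δ + Real.log a := by linarith [h.2]
    calc b = Real.exp (Real.log b) := (Real.exp_log hb).symm
      _ ≤ Real.exp (δ + Real.log a) := Real.exp_le_exp.2 h2
      _ = Real.exp δ * a := by rw [Real.exp_add, Real.exp_log ha]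

omit [Fintype X] in
/-- The target-weighted importance weight `p x · w x = p x² / q x` is nonnegative for `q x > 0`
(no sign hypothesis on `p`). [folklore] -/
theorem mul_weight_nonneg {p q : X → ℝ} {x : X} (hq : 0 < q x) :
    0 ≤ p x * weight p q x := by
  rw [mul_weight_eq_sq_div]
  exact div_nonneg (sq_nonneg _) hq.le

omit [Fintype X] in
/-- A model ratio bound transfers to the target-weighted weights the other way round: if
`q x ≤ e^δ · q' x` then `p x · w'(x) ≤ e^δ · p x · w(x)` (`w = p/q`, `w' = p/q'`). [folklore] -/
theorem mul_weight_le_exp_mul_of_model_le {p q q' : X → ℝ} {x : X} (hq : 0 < q x) (hq' : 0 < q' x)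
    {δ : ℝ} (h : q x ≤ Real.exp δ * q' x) :
    p x * weight p q' x ≤ Real.exp δ * (p x * weight p q x) := by
  rw [mul_weight_eq_sq_div, mul_weight_eq_sq_div, div_le_iff₀ hq']
  have h1 : Real.exp δ * (p x ^ 2 / q x) * q' x = p x ^ 2 * (Real.exp δ * q' x / q x) := by ring
  rw [h1]
  exact le_mul_of_one_le_right (sq_nonneg _) ((one_le_div hq).2 h)

omit [Fintype X] in
/-- At a parity point the two target-weighted weights differ by at most the factor `e^δ − 1`:
`|p·w − p·w'| ≤ (e^δ − 1)·p·w` at `x` when `|log q x − log q' x| ≤ δ`. [folklore] -/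
theorem abs_mul_weight_sub_le_of_abs_log_sub_le {p q q' : X → ℝ} {x : X}
    (hq : 0 < q x) (hq' : 0 < q' x) {δ : ℝ} (h : |Real.log (q x) - Real.log (q' x)| ≤ δ) :
    |p x * weight p q x - p x * weight p q' x| ≤ (Real.exp δ - 1) * (p x * weight p q x) := by
  have hqq := le_exp_mul_and_of_abs_log_sub_le hq hq' h
  have h1 : p x * weight p q' x ≤ Real.exp δ * (p x * weight p q x) :=
    mul_weight_le_exp_mul_of_model_le hq hq' hqq.1
  have h2 : p x * weight p q x ≤ Real.exp δ * (p x * weight p q' x) :=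
    mul_weight_le_exp_mul_of_model_le hq' hq hqq.2
  have ha : 0 ≤ p x * weight p q x := mul_weight_nonneg hq
  have hb : 0 ≤ p x * weight p q' x := mul_weight_nonneg hq'
  have hδ : 0 ≤ δ := (abs_nonneg _).trans h
  have he : 1 ≤ Real.exp δ := by linarith [Real.add_one_le_exp δ]
  rw [abs_sub_le_iff]
  constructor
  · rcases le_total (p x * weight p q x) (p x * weight p q' x) with hab | hba
    · linarith [mul_nonneg (sub_nonneg.2 he) ha]
    · -- `b ≥ a/e^δ ≥ (2 − e^δ)·a` since `(e^δ − 1)² ≥ 0`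
      nlinarith [mul_nonneg (sub_nonneg.2 he) (sub_nonneg.2 hba)]
  · linarith

end Pointwise

/-! ### §2 The law: target-side parity certifies `1/ESS` up to the exceptional importance masses -/

section Law

variable [DecidableEq X]

/-- **Upper half of the sandwich.**  If `|log q x − log q' x| ≤ δ` for every `x ∉ E` then
`1/ESS(p, q') ≤ e^δ · Σ_{x ∉ E} p·w + Σ_{x ∈ E} p·w'` — off `E` model B's target-weighted weights
are model A's up to `e^δ`; on `E` they enter as they are. [folklore] -/
theorem inv_essFrac_le_of_logParityOff {p q q' : X → ℝ} (hp1 : ∑ x, p x = 1)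
    (hq : ∀ x, 0 < q x) (hq' : ∀ x, 0 < q' x) (E : Finset X) {δ : ℝ}
    (hlog : ∀ x, x ∉ E → |Real.log (q x) - Real.log (q' x)| ≤ δ) :
    (essFrac p q')⁻¹ ≤
      Real.exp δ * (∑ x ∈ univ \ E, p x * weight p q x) + ∑ x ∈ E, p x * weight p q' x := by
  rw [essFrac_eq_inv hq' hp1, inv_inv, ← sum_sdiff (subset_univ E)]
  refine add_le_add ?_ le_rfl
  rw [mul_sum]
  refine sum_le_sum fun x hx => ?_
  have hxE : x ∉ E := (mem_sdiff.1 hx).2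
  exact mul_weight_le_exp_mul_of_model_le (hq x) (hq' x)
    (le_exp_mul_and_of_abs_log_sub_le (hq x) (hq' x) (hlog x hxE)).1

/-- **Lower half of the sandwich.**  Under the same parity off `E`:
`e^{−δ} · Σ_{x ∉ E} p·w + Σ_{x ∈ E} p·w' ≤ 1/ESS(p, q')`. [folklore] -/
theorem inv_essFrac_ge_of_logParityOff {p q q' : X → ℝ} (hp1 : ∑ x, p x = 1)
    (hq : ∀ x, 0 < q x) (hq' : ∀ x, 0 < q' x) (E : Finset X) {δ : ℝ}
    (hlog : ∀ x, x ∉ E → |Real.log (q x) - Real.log (q' x)| ≤ δ) :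
    Real.exp (-δ) * (∑ x ∈ univ \ E, p x * weight p q x) + ∑ x ∈ E, p x * weight p q' x ≤
      (essFrac p q')⁻¹ := by
  rw [essFrac_eq_inv hq' hp1, inv_inv, ← sum_sdiff (subset_univ E)]
  refine add_le_add ?_ le_rfl
  rw [mul_sum]
  refine sum_le_sum fun x hx => ?_
  have hxE : x ∉ E := (mem_sdiff.1 hx).2
  have h : p x * weight p q x ≤ Real.exp δ * (p x * weight p q' x) :=
    mul_weight_le_exp_mul_of_model_le (hq' x) (hq x)
      (le_exp_mul_and_of_abs_log_sub_le (hq x) (hq' x) (hlog x hxE)).2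
  rw [Real.exp_neg, inv_mul_le_iff₀ (Real.exp_pos δ)]
  exact h

/-- **The law of the target-side leg.**  At one target `p` (a probability vector), two positive
models that agree to `δ` in log off an exceptional set `E` have
`|1/ESS(p, q) − 1/ESS(p, q')| ≤ (e^δ − 1)·Σ_{x ∉ E} p·w + Σ_{x ∈ E} p·w + Σ_{x ∈ E} p·w'`:
the exceptional set enters through its TARGET-WEIGHTED importance masses under the two models
(compare `abs_accRate_sub_le_of_logParityOff`: for the acceptance it enters through its model
masses `q(E) + q'(E)`). [folklore] -/
theorem abs_inv_essFrac_sub_le_of_logParityOff {p q q' : X → ℝ}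
    (hp1 : ∑ x, p x = 1) (hq : ∀ x, 0 < q x) (hq' : ∀ x, 0 < q' x) (E : Finset X) {δ : ℝ}
    (hlog : ∀ x, x ∉ E → |Real.log (q x) - Real.log (q' x)| ≤ δ) :
    |(essFrac p q)⁻¹ - (essFrac p q')⁻¹| ≤
      (Real.exp δ - 1) * (∑ x ∈ univ \ E, p x * weight p q x) +
        (∑ x ∈ E, p x * weight p q x + ∑ x ∈ E, p x * weight p q' x) := by
  rw [essFrac_eq_inv hq hp1, essFrac_eq_inv hq' hp1, inv_inv, inv_inv,
    ← sum_sdiff (subset_univ E) (f := fun x => p x * weight p q x),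
    ← sum_sdiff (subset_univ E) (f := fun x => p x * weight p q' x)]
  set A := ∑ x ∈ univ \ E, p x * weight p q x with hA
  set A' := ∑ x ∈ univ \ E, p x * weight p q' x with hA'
  set B := ∑ x ∈ E, p x * weight p q x with hB
  set B' := ∑ x ∈ E, p x * weight p q' x with hB'
  have hAA : |A - A'| ≤ (Real.exp δ - 1) * A := by
    rw [hA, hA', ← sum_sub_distrib, mul_sum]
    refine (abs_sum_le_sum_abs _ _).trans (sum_le_sum fun x hx => ?_)
    have hxE : x ∉ E := (mem_sdiff.1 hx).2
    exact abs_mul_weight_sub_le_of_abs_log_sub_le (hq x) (hq' x) (hlog x hxE)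
  have hB0 : 0 ≤ B := sum_nonneg fun x _ => mul_weight_nonneg (hq x)
  have hB'0 : 0 ≤ B' := sum_nonneg fun x _ => mul_weight_nonneg (hq' x)
  have hBB : |B - B'| ≤ B + B' := by
    rw [abs_sub_le_iff]
    constructor <;> linarith
  have hsplit : A + B - (A' + B') = (A - A') + (B - B') := by ring
  rw [hsplit]
  exact (abs_add_le _ _).trans (add_le_add hAA hBB)

/-- **The law on the ESS scale.**  With both models normalised and `δ ≥ 0`:
`|ESS(p, q) − ESS(p, q')| ≤ (e^δ − 1)·ESS(p, q') + Σ_{x ∈ E} p·w + Σ_{x ∈ E} p·w'`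
(`ESS ≤ 1`, `ESS·Σ_{x∉E} p·w ≤ 1`, and `|e − e'| = e·e'·|1/e − 1/e'|`). [folklore] -/
theorem abs_essFrac_sub_le_of_logParityOff {p q q' : X → ℝ}
    (hp1 : ∑ x, p x = 1) (hq : ∀ x, 0 < q x) (hq' : ∀ x, 0 < q' x) (hq1 : ∑ x, q x = 1)
    (hq1' : ∑ x, q' x = 1) (E : Finset X) {δ : ℝ} (hδ : 0 ≤ δ)
    (hlog : ∀ x, x ∉ E → |Real.log (q x) - Real.log (q' x)| ≤ δ) :
    |essFrac p q - essFrac p q'| ≤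
      (Real.exp δ - 1) * essFrac p q' +
        (∑ x ∈ E, p x * weight p q x + ∑ x ∈ E, p x * weight p q' x) := by
  set A := ∑ x ∈ univ \ E, p x * weight p q x with hA
  set B := ∑ x ∈ E, p x * weight p q x with hB
  set B' := ∑ x ∈ E, p x * weight p q' x with hB'
  have he : 0 < essFrac p q := essFrac_pos hq hp1
  have he' : 0 < essFrac p q' := essFrac_pos hq' hp1
  have he1 : essFrac p q ≤ 1 := essFrac_le_one hq hp1 hq1
  have he1' : essFrac p q' ≤ 1 := essFrac_le_one hq' hp1 hq1'
  have hlaw := abs_inv_essFrac_sub_le_of_logParityOff hp1 hq hq' E hlog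
  have hinv : (essFrac p q)⁻¹ = A + B := by
    rw [essFrac_eq_inv hq hp1, inv_inv, ← sum_sdiff (subset_univ E)]
  have hB0 : 0 ≤ B := sum_nonneg fun x _ => mul_weight_nonneg (hq x)
  have hB'0 : 0 ≤ B' := sum_nonneg fun x _ => mul_weight_nonneg (hq' x)
  have heA : essFrac p q * A ≤ 1 := by
    have hAle : A ≤ (essFrac p q)⁻¹ := by rw [hinv]; linarith
    calc essFrac p q * A ≤ essFrac p q * (essFrac p q)⁻¹ :=
          mul_le_mul_of_nonneg_left hAle he.le
      _ = 1 := mul_inv_cancel₀ he.ne'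
  have hee : essFrac p q * essFrac p q' ≤ 1 := by
    calc essFrac p q * essFrac p q' ≤ 1 * 1 := mul_le_mul he1 he1' he'.le zero_le_one
      _ = 1 := one_mul 1
  have hx : 0 ≤ Real.exp δ - 1 := by linarith [Real.add_one_le_exp δ]
  have key : essFrac p q - essFrac p q' =
      essFrac p q * essFrac p q' * ((essFrac p q')⁻¹ - (essFrac p q)⁻¹) := by
    field_simp
  rw [key, abs_mul, abs_of_pos (mul_pos he he'), abs_sub_comm]
  have h1 : (Real.exp δ - 1) * (essFrac p q * A) * essFrac p q' ≤
      (Real.exp δ - 1) * 1 * essFrac p q' :=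
    mul_le_mul_of_nonneg_right (mul_le_mul_of_nonneg_left heA hx) he'.le
  have h2 : essFrac p q * essFrac p q' * (B + B') ≤ 1 * (B + B') :=
    mul_le_mul_of_nonneg_right hee (add_nonneg hB0 hB'0)
  calc essFrac p q * essFrac p q' * |(essFrac p q)⁻¹ - (essFrac p q')⁻¹|
      ≤ essFrac p q * essFrac p q' * ((Real.exp δ - 1) * A + (B + B')) :=
        mul_le_mul_of_nonneg_left hlaw (mul_pos he he').le
    _ = (Real.exp δ - 1) * (essFrac p q * A) * essFrac p q' +
          essFrac p q * essFrac p q' * (B + B') := by ring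
    _ ≤ (Real.exp δ - 1) * 1 * essFrac p q' + 1 * (B + B') := add_le_add h1 h2
    _ = (Real.exp δ - 1) * essFrac p q' + (B + B') := by ring

/-- Simplified form: `|ESS(p, q) − ESS(p, q')| ≤ (e^δ − 1) + Σ_{x ∈ E} p·w + Σ_{x ∈ E} p·w'` — the
ESS column moves by at most the parity slack plus the two target-weighted importance masses of the
exceptional set (compare `abs_accRate_sub_le_exp_sub_one_add_mass`: `(e^δ − 1) + q(E) + q'(E)` for
the acceptance column). [folklore] -/
theorem abs_essFrac_sub_le_exp_sub_one_add_weightMass {p q q' : X → ℝ}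
    (hp1 : ∑ x, p x = 1) (hq : ∀ x, 0 < q x) (hq' : ∀ x, 0 < q' x) (hq1 : ∑ x, q x = 1)
    (hq1' : ∑ x, q' x = 1) (E : Finset X) {δ : ℝ} (hδ : 0 ≤ δ)
    (hlog : ∀ x, x ∉ E → |Real.log (q x) - Real.log (q' x)| ≤ δ) :
    |essFrac p q - essFrac p q'| ≤
      (Real.exp δ - 1) + (∑ x ∈ E, p x * weight p q x + ∑ x ∈ E, p x * weight p q' x) := by
  refine (abs_essFrac_sub_le_of_logParityOff hp1 hq hq' hq1 hq1' E hδ hlog).trans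
    (add_le_add ?_ le_rfl)
  have hx : 0 ≤ Real.exp δ - 1 := by linarith [Real.add_one_le_exp δ]
  calc (Real.exp δ - 1) * essFrac p q' ≤ (Real.exp δ - 1) * 1 :=
        mul_le_mul_of_nonneg_left (essFrac_le_one hq' hp1 hq1') hx
    _ = Real.exp δ - 1 := mul_one _

end Law

/-! ### §3 What the exceptional term is -/

section ExceptionalTerm

/-- **The law cannot lose the exceptional term**: for every set `E`,
`Σ_{x ∈ E} p·w ≤ 1/ESS(p, q)` — the target-weighted importance mass of any set is a floor under
`1/ESS`, however small the set's target or model probability. [folklore] -/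
theorem sum_mul_weight_le_inv_essFrac {p q : X → ℝ} (hp1 : ∑ x, p x = 1)
    (hq : ∀ x, 0 < q x) (E : Finset X) :
    ∑ x ∈ E, p x * weight p q x ≤ (essFrac p q)⁻¹ := by
  rw [essFrac_eq_inv hq hp1, inv_inv]
  exact sum_le_sum_of_subset_of_nonneg (subset_univ E) fun x _ _ => mul_weight_nonneg (hq x)

omit [Fintype X] in
/-- **Target mean = model second moment**: `Σ_{x ∈ E} p x · w x = Σ_{x ∈ E} q x · (w x)²` — the
exceptional term is the target expectation of `w·1_E` and, equally, the model expectation of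
`w²·1_E`. [folklore] -/
theorem sum_mul_weight_eq_sum_model_mul_weight_sq {p q : X → ℝ} (hq : ∀ x, 0 < q x)
    (E : Finset X) :
    ∑ x ∈ E, p x * weight p q x = ∑ x ∈ E, q x * weight p q x ^ 2 :=
  sum_congr rfl fun x _ => (mul_weight_sq (hq x).ne').symm

omit [Fintype X] in
/-- **Floor by the coverage ratio** (Cauchy–Schwarz on `E`):
`p(E)²/q(E) ≤ Σ_{x ∈ E} p x · w x`, i.e. the exceptional term is at least the target mass of `E`
times the under-coverage ratio `p(E)/q(E)`. [folklore] -/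
theorem sq_sum_div_sum_le_sum_mul_weight {p q : X → ℝ} (hq : ∀ x, 0 < q x) (E : Finset X) :
    (∑ x ∈ E, p x) ^ 2 / ∑ x ∈ E, q x ≤ ∑ x ∈ E, p x * weight p q x := by
  simp_rw [mul_weight_eq_sq_div]
  exact Finset.sq_sum_div_le_sum_sq_div E p (fun x _ => hq x)

omit [Fintype X] in
/-- **Ceiling by the weight level**: if `w ≤ W` on `E` then `Σ_{x ∈ E} p x · w x ≤ W · p(E)` —
the exceptional term is at most the target mass of `E` times the largest weight on `E`.
[folklore] -/
theorem sum_mul_weight_le_mul_sum_of_weight_le {p q : X → ℝ} (hp : ∀ x, 0 ≤ p x) (E : Finset X)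
    {W : ℝ} (hW : ∀ x ∈ E, weight p q x ≤ W) :
    ∑ x ∈ E, p x * weight p q x ≤ W * ∑ x ∈ E, p x := by
  rw [mul_sum]
  refine sum_le_sum fun x hx => ?_
  rw [mul_comm W]
  exact mul_le_mul_of_nonneg_left (hW x hx) (hp x)

end ExceptionalTerm

end Summit.Ventures.LatticeQCDFlow.Theory2.DensityParity
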